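import Summits.AtomisticToContinuum.Crystallization.Theorems.FrustratedLawDichotomyCellArith
import Summits.AtomisticToContinuum.Crystallization.Theorems.FrustratedLawDichotomyCellEnclosures

/-!
# FrustratedLawDichotomy · crux `AperiodicFrustratedLawGap` (stmt-AtomisticToContinuum-27623) — CELL-ARITH, the Lennard-Jones
# atoms: (238)'s window enclosures READ IN `ℤ` (decomp-a2c hand-1 g53; serves the columns of (251) `…CellTailsRem.lb_le_certFloorL_trunc`)

Every scalar closed form of the class-A/H certificate is, on a squared-distance window `t ∈ [lo, hi]` (`lo, hi` exact
positive rationals — in a K-file they are the Gram two-corner sums of (252)/CellAdmissible), bounded by (238)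
`…CellEnclosures` through the atoms `lo⁻¹ ^ k`, `hi⁻¹ ^ k`.  Here each such bound gets a COMPUTABLE scale-`S` integer
reading (`…CellArith.ipLo/ipHi/scHi`) and a soundness theorem concluding the real inequality a K-file must supply:

* §1 endpoint expressions: `psiLoZ/psiHiZ` (`ψ`), `psi1LoZ/psi1HiZ` (`ψ′`), `phi1LoZ/phi1HiZ` (`φ′`), `phi2LoZ/phi2HiZ` (`φ″`) and
  their window theorems (`psiLoZ_le : lo ≤ t ≤ hi → psiLoZ ≤ S·ψ(t)`, …), `absPsi1HiZ`, `absPhi2HiZ`;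
* §2 ★ `secondNegHiZ` — `S·secondNeg r ≤ secondNegHiZ S lo hi` for `lo ≤ r² ≤ hi` ((238) `secondNeg_le`);
* the Taylor columns `forceRem`/`energyRem`/debit, the far columns `farCol`/`tailCol` and the signed four-corner products are the
  sequel `…CellArithTaylor` (same generation), split off for the 400-line rule.

Every `_expr` theorem reads the BOOKED EXPRESSION itself at rational endpoints (the interface of record, critic r1772 (B):
«S·snbW lo hi ≤ X», «S·psiAbsW lo hi ≤ X», … — (261) `…CellClasses` names those expressions; the adapters by name follow once it
is tree); the un-suffixed theorem composes with the (238) window lemma.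

Plain computable `def`s (`ℤ`/`ℚ`), no instance / notation / option; imports `…CellArith` (hand-1 g53) + (238); 0 sorry.  Tags: [folklore].
-/

namespace Summit.AtomisticToContinuum.Crystallization.Theorems.FrustratedLawDichotomyCellArithLJ

open Summit.AtomisticToContinuum.Crystallization.Theorems.FrustratedLawDichotomyCoherentFloorAlgebra
  (phiT1 phiT2 psiT psiT1 forceRem energyRem secondNeg)
open Summit.AtomisticToContinuum.Crystallization.Theorems.FrustratedLawDichotomyCoherentFloor (farCol tailCol)
open Summit.AtomisticToContinuum.Crystallization.Theorems.FrustratedLawDichotomyCellEnclosures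
  (psiT_mem psiT1_mem phiT1_mem phiT2_mem secondNeg_le forceRem_le_window energyRem_le_window farCol_anti tailCol_anti
    mul_le_of_corners corners_le_mul)
open Summit.AtomisticToContinuum.Crystallization.Theorems.FrustratedLawDichotomyCellArith

/-! ## §1 The endpoint expressions of (238) §2, read in `ℤ` -/

/-- lower reading of `hi⁻⁴ − lo⁻⁷` (the window floor of `ψ`). [folklore] -/
def psiLoZ (S : ℤ) (lo hi : ℚ) : ℤ := ipLo S hi 4 - ipHi S lo 7
/-- upper reading of `lo⁻⁴ − hi⁻⁷` (the window ceiling of `ψ`). [folklore] -/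
def psiHiZ (S : ℤ) (lo hi : ℚ) : ℤ := ipHi S lo 4 - ipLo S hi 7
/-- lower reading of `−4lo⁻⁵ + 7hi⁻⁸` (floor of `ψ′`). [folklore] -/
def psi1LoZ (S : ℤ) (lo hi : ℚ) : ℤ := -(4 * ipHi S lo 5) + 7 * ipLo S hi 8
/-- upper reading of `−4hi⁻⁵ + 7lo⁻⁸` (ceiling of `ψ′`). [folklore] -/
def psi1HiZ (S : ℤ) (lo hi : ℚ) : ℤ := -(4 * ipLo S hi 5) + 7 * ipHi S lo 8
/-- lower reading of `−½lo⁻⁷ + ½hi⁻⁴` (floor of `φ′`). [folklore] -/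
def phi1LoZ (S : ℤ) (lo hi : ℚ) : ℤ := -scHi (1 / 2) (ipHi S lo 7) + scLo (1 / 2) (ipLo S hi 4)
/-- upper reading of `−½hi⁻⁷ + ½lo⁻⁴` (ceiling of `φ′`). [folklore] -/
def phi1HiZ (S : ℤ) (lo hi : ℚ) : ℤ := -scLo (1 / 2) (ipLo S hi 7) + scHi (1 / 2) (ipHi S lo 4)
/-- lower reading of `(7/2)hi⁻⁸ − 2lo⁻⁵` (floor of `φ″`). [folklore] -/
def phi2LoZ (S : ℤ) (lo hi : ℚ) : ℤ := scLo (7 / 2) (ipLo S hi 8) - 2 * ipHi S lo 5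
/-- upper reading of `(7/2)lo⁻⁸ − 2hi⁻⁵` (ceiling of `φ″`). [folklore] -/
def phi2HiZ (S : ℤ) (lo hi : ℚ) : ℤ := scHi (7 / 2) (ipHi S lo 8) - 2 * ipLo S hi 5
/-- upper reading of the window bound `max (−floor) ceiling` of `|ψ′|`. [folklore] -/
def absPsi1HiZ (S : ℤ) (lo hi : ℚ) : ℤ := max (-psi1LoZ S lo hi) (psi1HiZ S lo hi)
/-- upper reading of the window bound `max (−floor) ceiling` of `|φ″|`. [folklore] -/
def absPhi2HiZ (S : ℤ) (lo hi : ℚ) : ℤ := max (-phi2LoZ S lo hi) (phi2HiZ S lo hi)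
/-- upper reading of the window bound `max (−(hi⁻⁴ − lo⁻⁷)) (lo⁻⁴ − hi⁻⁷)` of `|ψ|` ((261)'s `psiAbsW`, the NASH number of a
multiplier-free label). [folklore] -/
def absPsiHiZ (S : ℤ) (lo hi : ℚ) : ℤ := max (-psiLoZ S lo hi) (psiHiZ S lo hi)

section Windows

variable {S : ℤ} {lo hi : ℚ} {t : ℝ}

/-- `psiLoZ ≤ S·(hi⁻⁴ − lo⁻⁷)`. [folklore] -/
theorem psiLoZ_le_expr (hS : 0 < S) (h0 : 0 < lo) (hh : 0 < hi) :
    ((psiLoZ S lo hi : ℤ) : ℝ) ≤ S * ((hi : ℝ)⁻¹ ^ 4 - (lo : ℝ)⁻¹ ^ 7) := by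
  have A := ipLo_le hS hh 4; have B := le_ipHi hS h0 7
  unfold psiLoZ; push_cast; linarith

/-- `S·(lo⁻⁴ − hi⁻⁷) ≤ psiHiZ`. [folklore] -/
theorem le_psiHiZ_expr (hS : 0 < S) (h0 : 0 < lo) (hh : 0 < hi) :
    S * ((lo : ℝ)⁻¹ ^ 4 - (hi : ℝ)⁻¹ ^ 7) ≤ ((psiHiZ S lo hi : ℤ) : ℝ) := by
  have A := le_ipHi hS h0 4; have B := ipLo_le hS hh 7
  unfold psiHiZ; push_cast; linarith

/-- `psi1LoZ ≤ S·(−4lo⁻⁵ + 7hi⁻⁸)`. [folklore] -/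
theorem psi1LoZ_le_expr (hS : 0 < S) (h0 : 0 < lo) (hh : 0 < hi) :
    ((psi1LoZ S lo hi : ℤ) : ℝ) ≤ S * (-4 * (lo : ℝ)⁻¹ ^ 5 + 7 * (hi : ℝ)⁻¹ ^ 8) := by
  have A := le_ipHi hS h0 5; have B := ipLo_le hS hh 8
  unfold psi1LoZ; push_cast; linarith

/-- `S·(−4hi⁻⁵ + 7lo⁻⁸) ≤ psi1HiZ`. [folklore] -/
theorem le_psi1HiZ_expr (hS : 0 < S) (h0 : 0 < lo) (hh : 0 < hi) :
    S * (-4 * (hi : ℝ)⁻¹ ^ 5 + 7 * (lo : ℝ)⁻¹ ^ 8) ≤ ((psi1HiZ S lo hi : ℤ) : ℝ) := by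
  have A := ipLo_le hS hh 5; have B := le_ipHi hS h0 8
  unfold psi1HiZ; push_cast; linarith

/-- `phi1LoZ ≤ S·(−½lo⁻⁷ + ½hi⁻⁴)`. [folklore] -/
theorem phi1LoZ_le_expr (hS : 0 < S) (h0 : 0 < lo) (hh : 0 < hi) :
    ((phi1LoZ S lo hi : ℤ) : ℝ) ≤ S * (-(1 / 2) * (lo : ℝ)⁻¹ ^ 7 + 1 / 2 * (hi : ℝ)⁻¹ ^ 4) := by
  have A := le_scHi (c := 1 / 2) (by norm_num) (le_ipHi hS h0 7)
  have B := scLo_le (c := 1 / 2) (by norm_num) (ipLo_le hS hh 4)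
  unfold phi1LoZ; push_cast at A B ⊢; linarith

/-- `S·(−½hi⁻⁷ + ½lo⁻⁴) ≤ phi1HiZ`. [folklore] -/
theorem le_phi1HiZ_expr (hS : 0 < S) (h0 : 0 < lo) (hh : 0 < hi) :
    S * (-(1 / 2) * (hi : ℝ)⁻¹ ^ 7 + 1 / 2 * (lo : ℝ)⁻¹ ^ 4) ≤ ((phi1HiZ S lo hi : ℤ) : ℝ) := by
  have A := scLo_le (c := 1 / 2) (by norm_num) (ipLo_le hS hh 7)
  have B := le_scHi (c := 1 / 2) (by norm_num) (le_ipHi hS h0 4)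
  unfold phi1HiZ; push_cast at A B ⊢; linarith

/-- `phi2LoZ ≤ S·((7/2)hi⁻⁸ − 2lo⁻⁵)`. [folklore] -/
theorem phi2LoZ_le_expr (hS : 0 < S) (h0 : 0 < lo) (hh : 0 < hi) :
    ((phi2LoZ S lo hi : ℤ) : ℝ) ≤ S * (7 / 2 * (hi : ℝ)⁻¹ ^ 8 - 2 * (lo : ℝ)⁻¹ ^ 5) := by
  have A := scLo_le (c := 7 / 2) (by norm_num) (ipLo_le hS hh 8)
  have B := le_ipHi hS h0 5
  unfold phi2LoZ; push_cast at A B ⊢; linarith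

/-- `S·((7/2)lo⁻⁸ − 2hi⁻⁵) ≤ phi2HiZ`. [folklore] -/
theorem le_phi2HiZ_expr (hS : 0 < S) (h0 : 0 < lo) (hh : 0 < hi) :
    S * (7 / 2 * (lo : ℝ)⁻¹ ^ 8 - 2 * (hi : ℝ)⁻¹ ^ 5) ≤ ((phi2HiZ S lo hi : ℤ) : ℝ) := by
  have A := le_scHi (c := 7 / 2) (by norm_num) (le_ipHi hS h0 8)
  have B := ipLo_le hS hh 5
  unfold phi2HiZ; push_cast at A B ⊢; linarith

/-- positivity of the right endpoint of a nonempty window with positive left endpoint. -/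
theorem hi_pos_of_window (h0 : 0 < lo) (h1 : (lo : ℝ) ≤ t) (h2 : t ≤ (hi : ℝ)) : 0 < hi := by
  have : (0 : ℝ) < hi := lt_of_lt_of_le (by exact_mod_cast h0) (h1.trans h2)
  exact_mod_cast this

/-- ★ WINDOW FLOOR of `ψ`: `lo ≤ t ≤ hi ⇒ psiLoZ S lo hi ≤ S·ψ(t)`. [folklore] -/
theorem psiLoZ_le (hS : 0 < S) (h0 : 0 < lo) (h1 : (lo : ℝ) ≤ t) (h2 : t ≤ (hi : ℝ)) :
    ((psiLoZ S lo hi : ℤ) : ℝ) ≤ S * psiT t := by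
  have hS' : (0 : ℝ) < S := by exact_mod_cast hS
  have W := (psiT_mem (by exact_mod_cast h0) h1 h2).1
  have := psiLoZ_le_expr hS h0 (hi_pos_of_window h0 h1 h2)
  nlinarith

/-- ★ WINDOW CEILING of `ψ`: `lo ≤ t ≤ hi ⇒ S·ψ(t) ≤ psiHiZ S lo hi`. [folklore] -/
theorem le_psiHiZ (hS : 0 < S) (h0 : 0 < lo) (h1 : (lo : ℝ) ≤ t) (h2 : t ≤ (hi : ℝ)) :
    S * psiT t ≤ ((psiHiZ S lo hi : ℤ) : ℝ) := by
  have hS' : (0 : ℝ) < S := by exact_mod_cast hS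
  have W := (psiT_mem (by exact_mod_cast h0) h1 h2).2
  have := le_psiHiZ_expr hS h0 (hi_pos_of_window h0 h1 h2)
  nlinarith

/-- ★ WINDOW FLOOR of `ψ′`. [folklore] -/
theorem psi1LoZ_le (hS : 0 < S) (h0 : 0 < lo) (h1 : (lo : ℝ) ≤ t) (h2 : t ≤ (hi : ℝ)) :
    ((psi1LoZ S lo hi : ℤ) : ℝ) ≤ S * psiT1 t := by
  have hS' : (0 : ℝ) < S := by exact_mod_cast hS
  have W := (psiT1_mem (by exact_mod_cast h0) h1 h2).1
  have := psi1LoZ_le_expr hS h0 (hi_pos_of_window h0 h1 h2)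
  nlinarith

/-- ★ WINDOW CEILING of `ψ′`. [folklore] -/
theorem le_psi1HiZ (hS : 0 < S) (h0 : 0 < lo) (h1 : (lo : ℝ) ≤ t) (h2 : t ≤ (hi : ℝ)) :
    S * psiT1 t ≤ ((psi1HiZ S lo hi : ℤ) : ℝ) := by
  have hS' : (0 : ℝ) < S := by exact_mod_cast hS
  have W := (psiT1_mem (by exact_mod_cast h0) h1 h2).2
  have := le_psi1HiZ_expr hS h0 (hi_pos_of_window h0 h1 h2)
  nlinarith

/-- ★ WINDOW FLOOR of `φ′`. [folklore] -/
theorem phi1LoZ_le (hS : 0 < S) (h0 : 0 < lo) (h1 : (lo : ℝ) ≤ t) (h2 : t ≤ (hi : ℝ)) :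
    ((phi1LoZ S lo hi : ℤ) : ℝ) ≤ S * phiT1 t := by
  have hS' : (0 : ℝ) < S := by exact_mod_cast hS
  have W := (phiT1_mem (by exact_mod_cast h0) h1 h2).1
  have := phi1LoZ_le_expr hS h0 (hi_pos_of_window h0 h1 h2)
  nlinarith

/-- ★ WINDOW CEILING of `φ′`. [folklore] -/
theorem le_phi1HiZ (hS : 0 < S) (h0 : 0 < lo) (h1 : (lo : ℝ) ≤ t) (h2 : t ≤ (hi : ℝ)) :
    S * phiT1 t ≤ ((phi1HiZ S lo hi : ℤ) : ℝ) := by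
  have hS' : (0 : ℝ) < S := by exact_mod_cast hS
  have W := (phiT1_mem (by exact_mod_cast h0) h1 h2).2
  have := le_phi1HiZ_expr hS h0 (hi_pos_of_window h0 h1 h2)
  nlinarith

/-- ★ WINDOW FLOOR of `φ″`. [folklore] -/
theorem phi2LoZ_le (hS : 0 < S) (h0 : 0 < lo) (h1 : (lo : ℝ) ≤ t) (h2 : t ≤ (hi : ℝ)) :
    ((phi2LoZ S lo hi : ℤ) : ℝ) ≤ S * phiT2 t := by
  have hS' : (0 : ℝ) < S := by exact_mod_cast hS
  have W := (phiT2_mem (by exact_mod_cast h0) h1 h2).1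
  have := phi2LoZ_le_expr hS h0 (hi_pos_of_window h0 h1 h2)
  nlinarith

/-- ★ WINDOW CEILING of `φ″`. [folklore] -/
theorem le_phi2HiZ (hS : 0 < S) (h0 : 0 < lo) (h1 : (lo : ℝ) ≤ t) (h2 : t ≤ (hi : ℝ)) :
    S * phiT2 t ≤ ((phi2HiZ S lo hi : ℤ) : ℝ) := by
  have hS' : (0 : ℝ) < S := by exact_mod_cast hS
  have W := (phiT2_mem (by exact_mod_cast h0) h1 h2).2
  have := le_phi2HiZ_expr hS h0 (hi_pos_of_window h0 h1 h2)
  nlinarith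

/-- `S·max(−(ψ′ floor), ψ′ ceiling) ≤ absPsi1HiZ` (the `|ψ′|` factor of `forceRem_le_window`). [folklore] -/
theorem le_absPsi1HiZ_expr (hS : 0 < S) (h0 : 0 < lo) (hh : 0 < hi) :
    S * max (-(-4 * (lo : ℝ)⁻¹ ^ 5 + 7 * (hi : ℝ)⁻¹ ^ 8)) (-4 * (hi : ℝ)⁻¹ ^ 5 + 7 * (lo : ℝ)⁻¹ ^ 8)
      ≤ ((absPsi1HiZ S lo hi : ℤ) : ℝ) := by
  have A := psi1LoZ_le_expr hS h0 hh; have B := le_psi1HiZ_expr hS h0 hh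
  have A' : (S : ℝ) * -(-4 * (lo : ℝ)⁻¹ ^ 5 + 7 * (hi : ℝ)⁻¹ ^ 8) ≤ ((-psi1LoZ S lo hi : ℤ) : ℝ) := by
    push_cast; linarith
  have := max_le_max_readings A' B hS.le
  unfold absPsi1HiZ; exact this

/-- `S·max(−(φ″ floor), φ″ ceiling) ≤ absPhi2HiZ` (the `|φ″|` factor of `energyRem_le_window`). [folklore] -/
theorem le_absPhi2HiZ_expr (hS : 0 < S) (h0 : 0 < lo) (hh : 0 < hi) :
    S * max (-(7 / 2 * (hi : ℝ)⁻¹ ^ 8 - 2 * (lo : ℝ)⁻¹ ^ 5)) (7 / 2 * (lo : ℝ)⁻¹ ^ 8 - 2 * (hi : ℝ)⁻¹ ^ 5)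
      ≤ ((absPhi2HiZ S lo hi : ℤ) : ℝ) := by
  have A := phi2LoZ_le_expr hS h0 hh; have B := le_phi2HiZ_expr hS h0 hh
  have A' : (S : ℝ) * -(7 / 2 * (hi : ℝ)⁻¹ ^ 8 - 2 * (lo : ℝ)⁻¹ ^ 5) ≤ ((-phi2LoZ S lo hi : ℤ) : ℝ) := by
    push_cast; linarith
  have := max_le_max_readings A' B hS.le
  unfold absPhi2HiZ; exact this

/-- ★ `S·max(−(hi⁻⁴ − lo⁻⁷), lo⁻⁴ − hi⁻⁷) ≤ absPsiHiZ` — upper reading of (261)'s `psiAbsW lo hi` at rational endpoints. [folklore] -/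
theorem le_absPsiHiZ_expr (hS : 0 < S) (h0 : 0 < lo) (hh : 0 < hi) :
    S * max (-((hi : ℝ)⁻¹ ^ 4 - (lo : ℝ)⁻¹ ^ 7)) ((lo : ℝ)⁻¹ ^ 4 - (hi : ℝ)⁻¹ ^ 7) ≤ ((absPsiHiZ S lo hi : ℤ) : ℝ) := by
  have A := psiLoZ_le_expr hS h0 hh; have B := le_psiHiZ_expr hS h0 hh
  have A' : (S : ℝ) * -((hi : ℝ)⁻¹ ^ 4 - (lo : ℝ)⁻¹ ^ 7) ≤ ((-psiLoZ S lo hi : ℤ) : ℝ) := by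
    push_cast; linarith
  have := max_le_max_readings A' B hS.le
  unfold absPsiHiZ; exact this

/-- `S·|ψ(t)| ≤ absPsiHiZ` on the window. [folklore] -/
theorem le_absPsiHiZ (hS : 0 < S) (h0 : 0 < lo) (h1 : (lo : ℝ) ≤ t) (h2 : t ≤ (hi : ℝ)) :
    S * |psiT t| ≤ ((absPsiHiZ S lo hi : ℤ) : ℝ) := by
  have hS' : (0 : ℝ) < S := by exact_mod_cast hS
  have W := Summit.AtomisticToContinuum.Crystallization.Theorems.FrustratedLawDichotomyCellEnclosures.abs_le_max_neg
    (psiT_mem (by exact_mod_cast h0) h1 h2).1 (psiT_mem (by exact_mod_cast h0) h1 h2).2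
  have := le_absPsiHiZ_expr hS h0 (hi_pos_of_window h0 h1 h2)
  nlinarith

/-- `S·|ψ′(t)| ≤ absPsi1HiZ` on the window. [folklore] -/
theorem le_absPsi1HiZ (hS : 0 < S) (h0 : 0 < lo) (h1 : (lo : ℝ) ≤ t) (h2 : t ≤ (hi : ℝ)) :
    S * |psiT1 t| ≤ ((absPsi1HiZ S lo hi : ℤ) : ℝ) := by
  have hS' : (0 : ℝ) < S := by exact_mod_cast hS
  have W := Summit.AtomisticToContinuum.Crystallization.Theorems.FrustratedLawDichotomyCellEnclosures.abs_psiT1_le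
    (by exact_mod_cast h0) h1 h2
  have := le_absPsi1HiZ_expr hS h0 (hi_pos_of_window h0 h1 h2)
  nlinarith

end Windows

/-! ## §2 The second-order debit `secondNeg` -/

/-- upper reading of (238) `secondNeg_le`'s right-hand side `max 0 (−φ′floor + 2·hi·max 0 (−φ″floor))`. [folklore] -/
def secondNegHiZ (S : ℤ) (lo hi : ℚ) : ℤ :=
  max 0 (-phi1LoZ S lo hi + scHi (2 * hi) (max 0 (-phi2LoZ S lo hi)))

/-- ★ upper reading of the BOOKED EXPRESSION ((238) `secondNeg_le`'s right-hand side = (261)'s `snbW lo hi`) at rational endpoints: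
`S·max 0 (−(−½lo⁻⁷ + ½hi⁻⁴) + 2·hi·max 0 (−((7/2)hi⁻⁸ − 2lo⁻⁵))) ≤ secondNegHiZ S lo hi`. [folklore] -/
theorem le_secondNegHiZ_expr {S : ℤ} {lo hi : ℚ} (hS : 0 < S) (h0 : 0 < lo) (hh : 0 < hi) :
    S * max 0 (-(-(1 / 2) * (lo : ℝ)⁻¹ ^ 7 + 1 / 2 * (hi : ℝ)⁻¹ ^ 4)
        + 2 * (hi : ℝ) * max 0 (-(7 / 2 * (hi : ℝ)⁻¹ ^ 8 - 2 * (lo : ℝ)⁻¹ ^ 5)))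
      ≤ ((secondNegHiZ S lo hi : ℤ) : ℝ) := by
  have A := phi1LoZ_le_expr hS h0 hh
  have B := phi2LoZ_le_expr hS h0 hh
  have B' : (S : ℝ) * -(7 / 2 * (hi : ℝ)⁻¹ ^ 8 - 2 * (lo : ℝ)⁻¹ ^ 5) ≤ ((-phi2LoZ S lo hi : ℤ) : ℝ) := by
    push_cast; linarith
  have C := max_zero_le_reading B' hS.le
  have D := le_scHi (c := 2 * hi) (by positivity) C
  have E : (S : ℝ) * (-(-(1 / 2) * (lo : ℝ)⁻¹ ^ 7 + 1 / 2 * (hi : ℝ)⁻¹ ^ 4)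
      + 2 * (hi : ℝ) * max 0 (-(7 / 2 * (hi : ℝ)⁻¹ ^ 8 - 2 * (lo : ℝ)⁻¹ ^ 5)))
      ≤ ((-phi1LoZ S lo hi + scHi (2 * hi) (max 0 (-phi2LoZ S lo hi)) : ℤ) : ℝ) := by
    push_cast at D ⊢
    have : (S : ℝ) * (2 * (hi : ℝ) * max 0 (-(7 / 2 * (hi : ℝ)⁻¹ ^ 8 - 2 * (lo : ℝ)⁻¹ ^ 5)))
        = S * ((2 * (hi : ℝ)) * max 0 (-(7 / 2 * (hi : ℝ)⁻¹ ^ 8 - 2 * (lo : ℝ)⁻¹ ^ 5))) := by ring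
    linarith
  have F := max_zero_le_reading E hS.le
  unfold secondNegHiZ
  exact F

/-- ★ `lo ≤ r² ≤ hi ⇒ S·secondNeg r ≤ secondNegHiZ S lo hi` ((238) `secondNeg_le` ∘ `le_secondNegHiZ_expr`). [folklore] -/
theorem le_secondNegHiZ {S : ℤ} {lo hi : ℚ} {r : ℝ} (hS : 0 < S) (h0 : 0 < lo) (h1 : (lo : ℝ) ≤ r ^ 2)
    (h2 : r ^ 2 ≤ (hi : ℝ)) : S * secondNeg r ≤ ((secondNegHiZ S lo hi : ℤ) : ℝ) := by
  have hS' : (0 : ℝ) < S := by exact_mod_cast hS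
  have W := secondNeg_le (by exact_mod_cast h0) h1 h2
  exact (mul_le_mul_of_nonneg_left W hS'.le).trans (le_secondNegHiZ_expr hS h0 (hi_pos_of_window h0 h1 h2))

end Summit.AtomisticToContinuum.Crystallization.Theorems.FrustratedLawDichotomyCellArithLJ
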